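import Literature.NumberTheory.GaloisRepresentations.HeckeCharacterConductorExponentProofs
import Literature.NumberTheory.GaloisRepresentations.GenusHeckeCharacterConductorProofs
import Literature.NumberTheory.GaussSums.PadicUnitCharacterPrimitiveGaussSum
import HarnessLib

/-!
# The local component `χ_w` at a place of degree one over `p`, modelled on `ℤ_pˣ`:
# congruence filtration = `p`-adic balls, and a RAMIFIED `χ_w` has non-vanishing Gauss sum mod `𝔣`

Topic `NumberTheory/GaloisRepresentations`; PROOFS file (theorems only: no definition, no named fact,
no instance — D-0026 net debt 0). Companion of `HeckeCharacterConductorExponent(Proofs).lean` (the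
congruence filtration `U_w^{(f)}`, `IsTrivialOnHigherUnitsAt`, `HasConductorExponentAt`,
`conductorExponentAt`) and of `GaussSums/PadicUnitCharacterPrimitiveGaussSum.lean` (a character of
`ℤ_pˣ` of conductor exactly `p^n` has non-vanishing Gauss sum mod `p^n`).

For a number field `K`, a Hecke character `χ`, and a finite place `w ∣ p` OF DEGREE ONE
(`e(w|p) = f(w|p) = 1`, so `K_w = ℚ_p`: Cassels–Fröhlich II §10 "`[K_w : ℚ_p] = e f`"; e.g. a split
prime of an imaginary quadratic field) we transport `χ_w|_{𝒪_wˣ}` to a multiplicative character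
`ψ : MulChar ℤ_[p] ℂ` along the canonical identifications `ℚ_p ≅ ℚ_{(p)} → K_w` of the tree
(`Rat.toPadic`, `Automorphic.adicCompletionOfLiesOver`, onto at degree one:
`Automorphic.surjective_adicCompletionOfLiesOver`, valuation-preserving:
`Automorphic.valued_adicCompletionOfLiesOver_of_ramificationIdx_eq_one`):

* `HeckeCharacter.exists_mulChar_padicInt_model` — there is `ψ : MulChar ℤ_[p] ℂ` with
  (i) `ψ(k) = χ_w(k)` for every natural number `k` prime to `p` (read as a unit of `K_w`), and
  (ii) for every `f`, `χ_w(U_w^{(f)}) = 1 ↔ ψ(1 + p^f ℤ_p) = 1` — the congruence filtration of `𝒪_wˣ`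
  IS the filtration of `ℤ_pˣ` by the balls `‖u − 1‖ ≤ p^{−f}` (Tate §2.3, Neukirch VII (6.10) at a place
  with `𝒪_w = ℤ_p`).
* `HeckeCharacter.sum_localComponent_natCast_mul_stdAddChar_ne_zero_of_not_isUnramifiedAt` — if `χ` is
  RAMIFIED at `w`, with conductor exponent `n = f(χ_w) ≥ 1`, then
  `Σ_{k < p^n, p ∤ k} χ_w(k) · e^{2πik/p^n} ≠ 0`: the Gauss sum of `χ_w|_{𝒪_wˣ}` mod its conductor
  `𝔣 = 𝔭_w^n`, computed on the natural representatives of `(𝒪_w/𝔣)ˣ = (ℤ/p^n)ˣ` (Tate §2.5: the local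
  root number of a ramified character is a Gauss sum of absolute value `N𝔣^{1/2}`; Neukirch VII (2.6)).

The second statement is exactly "a RAMIFIED `χ_w` is NOT EXCEPTIONAL" in Disegni's sense (Compos. Math.
153 (2017), Def. 4 with Thm A's ramified branch `Z_w = τ(χ̃_w, ψ_{E_w})` = this sum up to the unit
`(χ_w(p)·α)^{−n}`, arXiv:1510.02114 pp. 6–7) — the (Δ2) discharge of road (C) on the BSD crux
`PrintCf2.SplitBadTwoRankOneOfFacts` (cell `bsd-print-cf2`; typer file
`Disegni2017/ChiLineRankinSelberg.lean`: `localGaussSum χ w (conductorExponentAt χ w)`,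
`isNotExceptionalAt_iff_of_not_isUnramifiedAt`). The value function is quantified (`val k = χ_w(k)` on
`p ∤ k`) so that any packaging of "`k` as a unit of `K_w`" is served. Nothing about BSD is proved here.

## References

* J. Tate, *Fourier analysis in number fields and Hecke's zeta-functions* (1950/1967), §2.3 (conductor),
  §2.5 (local factor `ρ` of a ramified character = Gauss sum, `|ρ| = 1`). [TateThesis1967]
* J. Neukirch, *Algebraic Number Theory* (1999), Ch. VII §6 (6.10)–(6.11); Ch. VII §2 Prop. (2.6);
  Ch. II Prop. (6.8). [NeukirchANT1999]
* J. W. S. Cassels, A. Fröhlich (eds.), *Algebraic Number Theory* (1967), Ch. II §10. [CasselsFrohlichANT1967]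
* D. Disegni, Compos. Math. 153 (2017), Thm A and Def. 4 (arXiv:1510.02114 pp. 6–7). [Disegni2017]
-/

noncomputable section

open scoped NumberField
open NumberField IsDedekindDomain IsDedekindDomain.HeightOneSpectrum Rat.HeightOneSpectrum
  Literature.NumberTheory.Automorphic

namespace Literature.NumberTheory.GaloisRepresentations

namespace HeckeCharacter

/-! ### §0 Plumbing -/

/-- An element of `K_v` of valuation `1` is (the image of) a unit of `𝒪_v` (private plumbing).
[folklore] -/
private theorem exists_units_adicCompletionIntegers_coe_eq'' {K : Type*} [Field K] [NumberField K]
    {v : HeightOneSpectrum (𝓞 K)} (y : v.adicCompletion K) (hy : Valued.v y = 1) :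
    ∃ u : (v.adicCompletionIntegers K)ˣ,
      ((u : v.adicCompletionIntegers K) : v.adicCompletion K) = y := by
  have hy0 : y ≠ 0 := (Valuation.ne_zero_iff _).mp (by rw [hy]; exact one_ne_zero)
  have hy' : Valued.v y⁻¹ = 1 := by rw [map_inv₀, hy, inv_one]
  exact ⟨⟨⟨y, hy.le⟩, ⟨y⁻¹, hy'.le⟩, Subtype.ext (mul_inv_cancel₀ hy0),
    Subtype.ext (inv_mul_cancel₀ hy0)⟩, rfl⟩

/-- The unit `Units.map 𝒪_v.subtype u ∈ K_vˣ` of a unit `u` of `𝒪_v` is `u` in `K_v` (private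
plumbing). [folklore] -/
private theorem coe_unitsMap_subtype'' {K : Type*} [Field K] [NumberField K] {v : HeightOneSpectrum (𝓞 K)}
    (u : (v.adicCompletionIntegers K)ˣ) :
    ((Units.map ((v.adicCompletionIntegers K).subtype : _ →* _) u : (v.adicCompletion K)ˣ) :
        v.adicCompletion K) = ((u : v.adicCompletionIntegers K) : v.adicCompletion K) := rfl

/-- `‖z‖ = 1 ↔ v(τ⁻¹ z … )`: an element of `ℚ_v` has valuation `1` iff its image in `ℚ_p` has norm
`1` (private plumbing; from `Rat.norm_toPadic_le_one_iff` applied to `y` and `y⁻¹`). [folklore] -/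
private theorem valued_eq_one_iff_norm_toPadic_eq_one (v : HeightOneSpectrum (𝓞 ℚ))
    (y : v.adicCompletion ℚ) : Valued.v y = 1 ↔ ‖Rat.toPadic v y‖ = 1 := by
  rcases eq_or_ne y 0 with rfl | hy0
  · simp
  constructor
  · intro h
    refine le_antisymm ((Rat.norm_toPadic_le_one_iff v y).mpr h.le) ?_
    have hinv : ‖Rat.toPadic v y⁻¹‖ ≤ 1 :=
      (Rat.norm_toPadic_le_one_iff v _).mpr (by rw [map_inv₀, h, inv_one])
    rw [map_inv₀, norm_inv] at hinv
    have hpos : 0 < ‖Rat.toPadic v y‖ :=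
      norm_pos_iff.mpr ((map_ne_zero_iff _ (Rat.toPadic v).injective).mpr hy0)
    exact (inv_le_one₀ hpos).mp hinv
  · intro h
    refine le_antisymm ((Rat.norm_toPadic_le_one_iff v y).mp h.le) ?_
    have hinv : Valued.v y⁻¹ ≤ 1 :=
      (Rat.norm_toPadic_le_one_iff v _).mp (by rw [map_inv₀, norm_inv, h, inv_one])
    rw [map_inv₀] at hinv
    have hpos : 0 < Valued.v y := zero_lt_iff.mpr ((Valuation.ne_zero_iff _).mpr hy0)
    exact (inv_le_one₀ hpos).mp hinv

/-! ### §1 Transport of `χ_w|_{𝒪_wˣ}` to a character of `ℤ_pˣ` at a place of degree one -/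

section Model

variable {K : Type} [Field K] [NumberField K]

/-- **`χ_w|_{𝒪_wˣ}` as a character of `ℤ_pˣ`, at a place `w ∣ p` of degree one.** For a Hecke
character `χ` of `K` and a finite place `w` above `p` with `e(w|p) = f(w|p) = 1` (`K_w = ℚ_p`,
Cassels–Fröhlich II §10), there is a multiplicative character `ψ : MulChar ℤ_[p] ℂ` (zero off
`ℤ_pˣ`) such that (i) `ψ(k) = χ_w(k)` for every natural number `k` prime to `p`, read as a unit
`U ∈ K_wˣ` with `U = k`; (ii) for every `f`, `χ_w` is trivial on `U_w^{(f)} = 1 + 𝔭_w^f` iff `ψ` is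
trivial on `1 + p^f ℤ_p` — the congruence filtrations correspond under `𝒪_w = ℤ_p` (Tate §2.3;
Neukirch VII (6.10)). Construction: `ψ = χ_w ∘ ι ∘ τ⁻¹` on units, with `τ : ℚ_{(p)} ≃ ℚ_p`
(`Rat.toPadic`) and `ι : ℚ_{(p)} → K_w` the canonical map, onto and valuation-preserving at degree one
(`Automorphic.surjective_adicCompletionOfLiesOver`, `…valued_adicCompletionOfLiesOver_of_ramificationIdx_eq_one`).
[cite: TateThesis1967, §2.3] [cite: NeukirchANT1999, Ch. VII §6 (6.10)] [cite: CasselsFrohlichANT1967, Ch. II §10] -/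
theorem exists_mulChar_padicInt_model (p : ℕ) [hp : Fact p.Prime] (χ : HeckeCharacter K)
    (w : HeightOneSpectrum (𝓞 K)) (hw : ((p : ℕ) : 𝓞 K) ∈ w.asIdeal)
    (he : w.asIdeal.ramificationIdx (𝓞 ℚ) = 1) (hf : w.asIdeal.inertiaDeg (𝓞 ℚ) = 1) :
    ∃ ψ : MulChar ℤ_[p] ℂ,
      (∀ (k : ℕ), p.Coprime k → ∀ U : (w.adicCompletion K)ˣ,
          (U : w.adicCompletion K) = (k : w.adicCompletion K) → ψ (k : ℤ_[p]) = χ.localComponent w U) ∧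
      (∀ f : ℕ, χ.IsTrivialOnHigherUnitsAt w f ↔
          ∀ u : ℤ_[p]ˣ, ‖(u : ℤ_[p]) - 1‖ ≤ (p : ℝ) ^ (-(f : ℤ)) → ψ u = 1) := by
  -- the place `v = (p)` of `ℚ` below `w`, `p_v = p`
  set v : HeightOneSpectrum (𝓞 ℚ) := w.under (𝓞 ℚ) with hv
  haveI : w.asIdeal.LiesOver v.asIdeal := ⟨rfl⟩
  have hvp : natGenerator v = p :=
    LocalField.natGenerator_eq_of_natCast_mem p v (LocalField.natCast_mem_under p w hw)
  subst hvp
  -- `ι : ℚ_v → K_w` (onto, valuation-preserving) and `τ : ℚ_v ≃ ℚ_p`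
  set ι := adicCompletionOfLiesOver ℚ K v w with hι
  have hval : ∀ y, Valued.v (ι y) = Valued.v y :=
    valued_adicCompletionOfLiesOver_of_ramificationIdx_eq_one ℚ K v w he
  have hsurj : Function.Surjective ι := surjective_adicCompletionOfLiesOver ℚ K v w he hf
  set τ := Rat.toPadic v with hτ
  -- `ρ : ℚ_p → K_w` and the unit-group map `Φ : ℤ_pˣ → K_wˣ`
  set ρ : ℚ_[natGenerator v] →+* w.adicCompletion K := ι.comp τ.symm.toRingHom with hρ
  set Φ : ℤ_[natGenerator v]ˣ →* (w.adicCompletion K)ˣ :=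
    (Units.map ρ.toMonoidHom).comp (Units.map (PadicInt.Coe.ringHom (p := natGenerator v)).toMonoidHom)
    with hΦ
  have hΦval : ∀ u : ℤ_[natGenerator v]ˣ,
      ((Φ u : (w.adicCompletion K)ˣ) : w.adicCompletion K) = ι (τ.symm ((u : ℤ_[natGenerator v]) : ℚ_[natGenerator v])) :=
    fun u => rfl
  refine ⟨MulChar.ofUnitHom ((χ.localComponent w).comp Φ), ?_, ?_⟩
  · -- (i) values at natural numbers prime to `p`
    intro k hk U hU
    have hunit : IsUnit ((k : ℕ) : ℤ_[natGenerator v]) :=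
      PadicInt.isUnit_iff.mpr (PadicInt.norm_natCast_eq_one_iff.mpr hk)
    obtain ⟨uk, huk⟩ := hunit
    have hΦuk : Φ uk = U := by
      refine Units.ext ?_
      rw [hΦval, huk, PadicInt.coe_natCast, map_natCast, map_natCast, hU]
    rw [← huk, MulChar.ofUnitHom_coe, MonoidHom.comp_apply, hΦuk]
  · -- (ii) the congruence filtrations correspond
    intro f
    constructor
    · intro h u hu
      -- `y = τ⁻¹ u ∈ ℚ_v` is a unit with `v(y - 1) ≤ ϖ^f`; `ι y` is a unit of `𝒪_w` in `U_w^{(f)}`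
      set y : v.adicCompletion ℚ := τ.symm ((u : ℤ_[natGenerator v]) : ℚ_[natGenerator v]) with hy
      have hτy : τ y = ((u : ℤ_[natGenerator v]) : ℚ_[natGenerator v]) := τ.apply_symm_apply _
      have hy1 : Valued.v y = 1 := by
        rw [valued_eq_one_iff_norm_toPadic_eq_one, ← hτ, hτy, ← PadicInt.norm_def]
        exact PadicInt.isUnit_iff.mp u.isUnit
      have hyf : Valued.v (y - 1) ≤ WithZero.exp (-(f : ℤ)) := by
        rw [Rat.valued_le_iff_norm_toPadic_le, ← hτ, map_sub, map_one, hτy, ← PadicInt.coe_one,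
          ← PadicInt.coe_sub, ← PadicInt.norm_def]
        exact hu
      have hιy1 : Valued.v (ι y) = 1 := by rw [hval, hy1]
      obtain ⟨u', hu'⟩ := exists_units_adicCompletionIntegers_coe_eq'' _ hιy1
      have hu'f : Valued.v (((u' : w.adicCompletionIntegers K) : w.adicCompletion K) - 1) ≤
          WithZero.exp (-(f : ℤ)) := by
        rw [hu', ← map_one ι, ← map_sub, hval]
        exact hyf
      have h1 := h u' hu'f
      have hmap : Units.map ((w.adicCompletionIntegers K).subtype : _ →* _) u' = Φ u :=
        Units.ext (by rw [coe_unitsMap_subtype'', hu', hΦval])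
      rw [hmap] at h1
      rw [MulChar.ofUnitHom_coe, MonoidHom.comp_apply, h1, Units.val_one]
    · intro h u' hu'
      -- `u' = ι y`, `y ∈ ℚ_v` a unit with `v(y - 1) ≤ ϖ^f`; `u = τ y ∈ ℤ_pˣ` with `‖u - 1‖ ≤ p^{-f}`
      obtain ⟨y, hy⟩ := hsurj (((u' : w.adicCompletionIntegers K) : w.adicCompletion K))
      have hy1 : Valued.v y = 1 := by
        rw [← hval, hy]; exact valued_coe_units_adicCompletionIntegers u'
      have hnorm : ‖τ y‖ = 1 := (valued_eq_one_iff_norm_toPadic_eq_one v y).mp hy1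
      set u : ℤ_[natGenerator v]ˣ := PadicInt.mkUnits hnorm with hu
      have hucoe : ((u : ℤ_[natGenerator v]) : ℚ_[natGenerator v]) = τ y := PadicInt.mkUnits_eq hnorm
      have hyf : Valued.v (y - 1) ≤ WithZero.exp (-(f : ℤ)) := by
        rw [← hval, map_sub, map_one, hy]; exact hu'
      have huf : ‖(u : ℤ_[natGenerator v]) - 1‖ ≤ (natGenerator v : ℝ) ^ (-(f : ℤ)) := by
        rw [PadicInt.norm_def, PadicInt.coe_sub, PadicInt.coe_one, hucoe, ← map_one τ, ← map_sub]
        exact (Rat.valued_le_iff_norm_toPadic_le v _ f).mp hyf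
      have h1 := h u huf
      rw [MulChar.ofUnitHom_coe, MonoidHom.comp_apply] at h1
      have hmap : Φ u = Units.map ((w.adicCompletionIntegers K).subtype : _ →* _) u' :=
        Units.ext (by rw [coe_unitsMap_subtype'', hΦval, hucoe, τ.symm_apply_apply, hy])
      rw [hmap] at h1
      exact Units.val_eq_one.mp h1

end Model

/-! ### §2 A ramified `χ_w` at a place of degree one has non-vanishing Gauss sum mod its conductor -/

section GaussSum

variable {K : Type} [Field K] [NumberField K]

/-- **`Σ_{k < p^n, p ∤ k} χ_w(k) e^{2πik/p^n} ≠ 0` for `χ` RAMIFIED at a degree-one place `w ∣ p`,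
`n = f(χ_w)` its conductor exponent.** Here `val : ℕ → ℂ` is ANY function with `val k = χ_w(k)` (the
local component at the unit `k ∈ K_wˣ`) for `p ∤ k` — the sum is the Gauss sum of `χ_w|_{𝒪_wˣ}` mod
its conductor `𝔣 = 𝔭_w^n` on the natural representatives of `(𝒪_w/𝔣)ˣ = (ℤ/p^n)ˣ`, and
`χ_w|_{𝒪_wˣ}` transported to `ℤ_pˣ` (§1) has conductor exactly `p^n` (`hasConductorExponentAt_conductorExponentAt`),
so the sum is the Gauss sum of a PRIMITIVE Dirichlet character mod `p^n`
(`GaussSums.sum_range_mul_stdAddChar_ne_zero_of_conductor`), of absolute value `p^{n/2}` (Tate §2.5,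
Neukirch VII (2.6)). In Disegni's Theorem A this is the ramified branch `Z_w = τ(χ̃_w, ψ_{E_w}) ≠ 0`:
a ramified `χ_w` is never exceptional (Def. 4). [cite: TateThesis1967, §2.3 and §2.5]
[cite: NeukirchANT1999, Ch. VII §2 Prop. (2.6) and §6 (6.10)]
[cite: Disegni2017, Theorem A (Z_w) and Definition 4 (arXiv:1510.02114 pp. 6–7)] -/
theorem sum_localComponent_natCast_mul_stdAddChar_ne_zero_of_not_isUnramifiedAt (p : ℕ)
    [hp : Fact p.Prime] (χ : HeckeCharacter K) (w : HeightOneSpectrum (𝓞 K))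
    (hw : ((p : ℕ) : 𝓞 K) ∈ w.asIdeal)
    (he : w.asIdeal.ramificationIdx (𝓞 ℚ) = 1) (hf : w.asIdeal.inertiaDeg (𝓞 ℚ) = 1)
    (hram : ¬ χ.IsUnramifiedAt w) (val : ℕ → ℂ)
    (hval : ∀ k : ℕ, p.Coprime k → ∃ U : (w.adicCompletion K)ˣ,
      (U : w.adicCompletion K) = (k : w.adicCompletion K) ∧ val k = χ.localComponent w U) :
    ∑ k ∈ (Finset.range (p ^ χ.conductorExponentAt w)).filter (fun k => p.Coprime k),
      val k * ZMod.stdAddChar (N := p ^ χ.conductorExponentAt w)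
        (k : ZMod (p ^ χ.conductorExponentAt w)) ≠ 0 := by
  set n := χ.conductorExponentAt w with hn
  obtain ⟨ψ, hψval, hψfil⟩ := exists_mulChar_padicInt_model p χ w hw he hf
  have hcond := hasConductorExponentAt_conductorExponentAt χ w
  -- `n ≥ 1` since `χ` is ramified at `w`
  have hn0 : n ≠ 0 := by
    intro h0
    exact hram ((conductorExponentAt_eq_zero_iff χ w).mp h0)
  -- hypotheses of the `ℤ_p`-side theorem
  have htriv : ∀ u : ℤ_[p]ˣ, ‖(u : ℤ_[p]) - 1‖ ≤ (p : ℝ) ^ (-(n : ℤ)) → ψ u = 1 :=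
    (hψfil n).mp hcond.1
  have hmin : ∃ u : ℤ_[p]ˣ, ‖(u : ℤ_[p]) - 1‖ ≤ (p : ℝ) ^ (-((n - 1 : ℕ) : ℤ)) ∧ ψ u ≠ 1 := by
    have h := hcond.2 (n - 1) (by omega)
    rw [hψfil (n - 1)] at h
    push Not at h
    exact h
  have hne := Literature.NumberTheory.GaussSums.sum_range_mul_stdAddChar_ne_zero_of_conductor ψ hn0 htriv hmin
  -- compare the two sums termwise: `ψ(k) = val k` for `p ∤ k`, `ψ(k) = 0` for `p ∣ k`
  rw [Finset.sum_filter]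
  have hterm : ∀ k ∈ Finset.range (p ^ n),
      (if p.Coprime k then val k * ZMod.stdAddChar (N := p ^ n) (k : ZMod (p ^ n)) else 0) =
        ψ (k : ℤ_[p]) * ZMod.stdAddChar (N := p ^ n) (k : ZMod (p ^ n)) := by
    intro k _
    by_cases hk : p.Coprime k
    · obtain ⟨U, hU, hvalk⟩ := hval k hk
      rw [if_pos hk, hvalk, hψval k hk U hU]
    · have hnu : ¬ IsUnit ((k : ℕ) : ℤ_[p]) := fun h =>
        hk (PadicInt.norm_natCast_eq_one_iff.mp (PadicInt.isUnit_iff.mp h))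
      rw [if_neg hk, MulChar.map_nonunit _ hnu, zero_mul]
  rw [Finset.sum_congr rfl hterm]
  exact hne

/-- The same sum with the complementary filter `¬ p ∣ k` (equivalent indexing of the units mod `p^n`).
[cite: TateThesis1967, §2.5] [cite: NeukirchANT1999, Ch. VII §2 Prop. (2.6)] -/
theorem sum_localComponent_natCast_mul_stdAddChar_ne_zero_of_not_isUnramifiedAt' (p : ℕ)
    [hp : Fact p.Prime] (χ : HeckeCharacter K) (w : HeightOneSpectrum (𝓞 K))
    (hw : ((p : ℕ) : 𝓞 K) ∈ w.asIdeal)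
    (he : w.asIdeal.ramificationIdx (𝓞 ℚ) = 1) (hf : w.asIdeal.inertiaDeg (𝓞 ℚ) = 1)
    (hram : ¬ χ.IsUnramifiedAt w) (val : ℕ → ℂ)
    (hval : ∀ k : ℕ, ¬ p ∣ k → ∃ U : (w.adicCompletion K)ˣ,
      (U : w.adicCompletion K) = (k : w.adicCompletion K) ∧ val k = χ.localComponent w U) :
    ∑ k ∈ (Finset.range (p ^ χ.conductorExponentAt w)).filter (fun k => ¬ p ∣ k),
      val k * ZMod.stdAddChar (N := p ^ χ.conductorExponentAt w)
        (k : ZMod (p ^ χ.conductorExponentAt w)) ≠ 0 := by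
  have hiff : ∀ k : ℕ, p.Coprime k ↔ ¬ p ∣ k := fun k => (Nat.Prime.coprime_iff_not_dvd hp.out)
  have hfilter : (Finset.range (p ^ χ.conductorExponentAt w)).filter (fun k => ¬ p ∣ k) =
      (Finset.range (p ^ χ.conductorExponentAt w)).filter (fun k => p.Coprime k) :=
    Finset.filter_congr fun k _ => (hiff k).symm
  rw [hfilter]
  exact sum_localComponent_natCast_mul_stdAddChar_ne_zero_of_not_isUnramifiedAt p χ w hw he hf hram val
    fun k hk => hval k ((hiff k).mp hk)

end GaussSum

end HeckeCharacter

end Literature.NumberTheory.GaloisRepresentations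

end
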